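import Summits.CriticalPhenomena.SAWScalingLimit.Theses.SAWTotalPositivity
import Summits.CriticalPhenomena.SAWScalingLimit.Theorems.SAWTotalPositivityBoundaryTP2Defs
import Summits.CriticalPhenomena.SAWScalingLimit.Theorems.SAWTotalPositivityBoundaryTP2Kernel
import Summits.CriticalPhenomena.SAWScalingLimit.Theorems.SAWTotalPositivityBoundaryTP2Symmetry
import Summits.CriticalPhenomena.SAWScalingLimit.Theorems.SAWTotalPositivityBoundaryTP2FirstStep
import Summits.CriticalPhenomena.SAWScalingLimit.Theorems.SAWTotalPositivityBoundaryTP2CornerRecursion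
import Summits.CriticalPhenomena.SAWScalingLimit.Theorems.SAWTotalPositivityBoundaryTP2MainNonneg
import Summits.CriticalPhenomena.SAWScalingLimit.Theorems.SAWTotalPositivityBoundaryTP2StarDecomposition
import Summits.CriticalPhenomena.SAWScalingLimit.Theorems.BoundaryTP2Negative_WithoutInterlacing
import Summits.CriticalPhenomena.SAWScalingLimit.Theorems.BoundaryTP2Negative_Midpoints
import Summits.CriticalPhenomena.SAWScalingLimit.Theorems.BoundaryTP2Negative_TP3
import Literature.Probability.RandomPlanarGeometry.SAWBridgeRadius
import HarnessLib

/-!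
# SKELETON — crux `BoundaryTP2` (stmt-CriticalPhenomena-7115), line `corner-deletion-induction`

Idea card `Cruxes/BoundaryTP2/Ideas/corner-deletion-induction.md` (triage r1-1/2/3: pass), planner
`planner-cruxplan-stmt-CriticalPhenomena-7115-corner-deletion-indu-0`.

## The line

Delete a corner. By the landed Godsil / Heilmann–Lieb vertex recursion `stub_cornerRecursion`
(`…Theorems/SAWTotalPositivityBoundaryTP2CornerRecursion.lean`), for the fugacity-`x` path kernel
`Z = pathKernel H x` of a graph `H`, a quadruple `p₁ p₂ p₃ p₄` and the corner `p₃`,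

  `Z₁₂Z₃₄ + x·S⁻ + V₂₄Z₁₃ = Z₁₃Z₂₄ + x·S⁺ + V₁₂Z₃₄`,
  `S⁺ = Σ_{u∼p₃} A₁₂·A_{u4}`, `S⁻ = Σ_{u∼p₃} A_{1u}·A₂₄`,

where `A` (`V`) is the kernel of the paths avoiding (visiting) `p₃`; i.e. `det_H = Main + Corr` with
`Main = x(S⁺ − S⁻) = x Σ_{u∼p₃} det_{H−p₃}(p₁,p₂,u,p₄)` and `Corr = V₁₂Z₃₄ − V₂₄Z₁₃`. The line proves the
INTERLACING-ONLY strengthening `InterlacedTP2At x` (hypotheses (ii)/(iii) of the crux are not inherited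
by sub-instances; triage sharpening (1); disprover's census: interlacing alone is never violated) by
strong induction on the number of edges of `H ≤ ℤ²`, for every `x ∈ (0, x_c]`, from three stubs:

* `stub_mainNonneg` (M, provable now): the induction hypothesis on proper subgraphs gives `S⁻ ≤ S⁺`
  (`Main ≥ 0`) at a corner `p₃` that has a neighbour other than `p₄` — interlacing is inherited
  (`stub_interlaced_deleteVert`, landed), the avoiding kernel is the kernel of `H − p₃`
  (`stub_pathKernelOn_avoid`, landed); the degenerate terms are `u = p₂` (zero), `u = p₄` (the TP₂
  instance `(p₁,p₂,p₃,p₄)` of the proper subgraph `(H − p₃) + edge p₃p₄`) and `u = p₁` (then `{p₁,p₃}`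
  separates `p₂` from `p₄` by interlacing, so `A₂₄ ≤ A₁₂A₁₄` by splitting at the forced vertex `p₁`).
* `stub_starDecomposition` (M, provable now, any graph, any `x ≥ 0`): splitting the paths through `p₃`
  at `p₃` writes both products `V₁₂Z₃₄` and `V₂₄Z₁₃` as sums over THREE-ARM STARS at the corner
  (arms `α : p₁ → a`, `β : b → p₂`, `γ : c → p₄` in `H − p₃`, `a b c ∼ p₃`):
  `V₁₂Z₃₄ = T₀ + T_A`, `V₂₄Z₁₃ = T₀ + T_B` with `T₀ = T(α⊥β, β⊥γ)`, `T_A = T(α⊥β, β¬⊥γ)`,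
  `T_B = T(β⊥γ, α¬⊥β)` (so `Corr = T_A − T_B`: the card's `Corr = T(s₁⊥s₂, s₂∩s₄≠∅) − T(s₂⊥s₄, s₁∩s₂≠∅)`).
* `stub_starDomination` (L+, THE BET = the card's Transfer `C⁺`, in the ∃-corner form asked for by
  triage r1-2/r1-3): a uniform `θ ∈ (0,1)` such that for every `x ∈ (0, x_c]`, every finite `H ≤ ℤ²`,
  every pairwise-distinct interlaced quadruple with `Z₁₃Z₂₄ ≠ 0`, and GIVEN interlacing-only TP₂ on all
  proper subgraphs of `H`, some Klein relabelling `q` of the quadruple (a corner of the prover's choice)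
  has a non-void corner `q₃` with `T_B(q) + (1−θ)x·S⁻(q) ≤ T_A(q) + (1−θ)x·S⁺(q)`, i.e.
  `−Corr ≤ (1−θ)·Main` (measured: `−Corr/Main ≤ 0.54` on every corner of every instance enumerated by
  the card and the three triagers; `≤ 0.31` on boxes; `= x_c² = 0.1437` exactly on ladders).

Composition (`BoundaryTP2_of`, proved here, no sorry outside the stubs): strong induction on
`H.edgeSet.ncard`; the trivial case `Z₁₃Z₂₄ = 0`; `stub_starDomination` picks the corner; at that corner
`stub_mainNonneg` + `stub_starDecomposition` + `stub_cornerRecursion` + the first-step identity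
(finiteness of `x·S⁺ + V₁₂Z₃₄ = A₁₂Z₃₄ + V₁₂Z₃₄`) give TP₂ by cancellation in `ℝ≥0∞`; the Klein
relabellings `tp2_of_swap/rotate/reflect` (landed `…Symmetry`) carry it back; then
`graphTP2At_of_interlacedTP2At` and the landed transfer `boundaryTP2_of_graphTP2At` conclude the crux
BY NAME at `x = x_c` (`SAW.criticalFugacity_pos`).

## Disproof / negatives honoured
`Negative.boundaryTP2_false_without_interlacing` — interlacing is kept verbatim in every stub and is the
hypothesis `stub_mainNonneg` uses (inheritance + the forced vertex); `Negative.not_midpointTP2_all_fugacities`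
/ `midpointTP2_fails_at_three_fifths` — the only fugacity-sensitive statement is `stub_starDomination`,
which is asserted for `x ≤ x_c` only and is KNOWN to fail above the TP₂ thresholds (ratio `−Corr/Main`
reaches `−1` exactly at `x*(G)`, card §(2)); `Negative.circularTP3_fails_at_xc` — order 2 only;
`Negative.exists_simplyConnected_domain_with_annular_meshGraph` — all stubs range over arbitrary finite
subgraphs of `ℤ²` (holes, non-induced edges included). Sanity enumeration of the statements AS TYPED
(planner folder `exp/corner_check.py`, exact rationals at x = 0.379 and 0.3): identities R and D hold on
every interlaced ordered quadruple of the test graphs, `S⁻ ≤ S⁺` at every non-void corner, best-corner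
ratio ≤ 0.19, worst any-corner ratio 0.307 (3×3 box, = the card's −0.307).
-/

noncomputable section

namespace Summit.CriticalPhenomena.SAWScalingLimit.Cruxes.BoundaryTP2.CornerDeletionInduction

open Summit.CriticalPhenomena.SAWScalingLimit.Theorems.BoundaryTP2
open Literature.Probability.LatticeModels Literature.Probability.RandomPlanarGeometry
open scoped ENNReal

/-! ## Registered stubs -/

/-! STUBS S1 `stub_mainNonneg` and S2 `stub_starDecomposition` are LANDED (p97209
`…Theorems/SAWTotalPositivityBoundaryTP2MainNonneg.lean`, p102675 `…StarDecomposition.lean` with helper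
p100701 `…StarArms.lean`), namespace `Summit.CriticalPhenomena.SAWScalingLimit.Theorems.BoundaryTP2` (opened
above); the composition below calls them by name. -/

open Classical in
/-- STUB S3 — THE BET (`StrictCornerDomination`, the card's Transfer `C⁺`, ∃-corner form; size L+).
There is a uniform `θ ∈ (0,1)` such that for every fugacity `0 < x ≤ x_c`, every `H ≤ ℤ²` with
finitely many non-isolated vertices, every pairwise-distinct interlaced quadruple whose crossing
products `Z₁₃Z₂₄` does not vanish, and GIVEN interlacing-only TP₂ at `x` on every proper subgraph of
`H` (the induction hypothesis — it makes every term of `Main` a settled smaller instance), SOME Klein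
relabelling `q` of the quadruple (the four relabellings preserve the instance; the corner is the
prover's choice) has a non-void corner `q₃` at which the three-arm remainder is strictly dominated by
the inductive main term: `T_B(q) + (1−θ)x·S⁻(q) ≤ T_A(q) + (1−θ)x·S⁺(q)`, i.e. `−Corr ≤ (1−θ)·Main`
(`T_A`, `T_B` as in `stub_starDecomposition`, `S±` as in `stub_mainNonneg`). Why it might be provable
with slack to spare: `Corr = −x²·Main + (corner excursions)` termwise in `u` (ladders: exactly
`−x_c²·Main`), and the measured ratio `−Corr/Main ∈ [0.14, 0.54]` at `x_c` on every corner of every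
enumerated instance (boxes ≤ 7×6, corridors, slits, L-shapes, opposite-corner clusters; card + triage
r1-1/2/3), creeping only with corridor WIDTH (`0.144, 0.175, ≈0.20, ≳0.23` for `w = 2…5`: the open
risk is `θ_∞(w) → 0`). It must use `x ≤ x_c` (`Negative.not_midpointTP2_all_fugacities`): the ratio
reaches `−1` exactly at the TP₂ threshold `x*(G) > x_c` of each family. A void corner (`q₃` a leaf
hanging on `q₄`) is excluded because there the domination is the instance itself. -/
theorem stub_starDomination :
    ∃ θ : ℝ, 0 < θ ∧ θ < 1 ∧ ∀ x : ℝ, 0 < x → x ≤ SAW.criticalFugacity →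
      ∀ H : SimpleGraph (Site 2), H ≤ zdGraph 2 → H.support.Finite →
        ∀ p₁ p₂ p₃ p₄ : Site 2, p₁ ≠ p₂ → p₁ ≠ p₃ → p₁ ≠ p₄ → p₂ ≠ p₃ → p₂ ≠ p₄ → p₃ ≠ p₄ →
          Interlaced H p₁ p₂ p₃ p₄ →
          (∀ H' : SimpleGraph (Site 2), H' ≤ H → H' ≠ H →
            ∀ q₁ q₂ q₃ q₄ : Site 2, q₁ ≠ q₂ → q₁ ≠ q₃ → q₁ ≠ q₄ → q₂ ≠ q₃ → q₂ ≠ q₄ → q₃ ≠ q₄ →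
              Interlaced H' q₁ q₂ q₃ q₄ →
                pathKernel H' x q₁ q₃ * pathKernel H' x q₂ q₄ ≤
                  pathKernel H' x q₁ q₂ * pathKernel H' x q₃ q₄) →
          pathKernel H x p₁ p₃ * pathKernel H x p₂ p₄ ≠ 0 →
          ∃ q₁ q₂ q₃ q₄ : Site 2,
            ((q₁, q₂, q₃, q₄) = (p₁, p₂, p₃, p₄) ∨ (q₁, q₂, q₃, q₄) = (p₂, p₁, p₄, p₃) ∨
              (q₁, q₂, q₃, q₄) = (p₃, p₄, p₁, p₂) ∨ (q₁, q₂, q₃, q₄) = (p₄, p₃, p₂, p₁)) ∧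
            (∃ u, H.Adj q₃ u ∧ u ≠ q₄) ∧
            ENNReal.ofReal x ^ 3 *
                (∑' (a : H.neighborSet q₃) (b : H.neighborSet q₃) (c : H.neighborSet q₃)
                    (α : (H.deleteEdges (H.incidenceSet q₃)).Path q₁ a)
                    (β : (H.deleteEdges (H.incidenceSet q₃)).Path b q₂)
                    (γ : (H.deleteEdges (H.incidenceSet q₃)).Path c q₄),
                  if List.Disjoint β.1.support γ.1.support ∧ ¬ List.Disjoint α.1.support β.1.support then
                    ENNReal.ofReal (x ^ α.1.length) * ENNReal.ofReal (x ^ β.1.length) *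
                      ENNReal.ofReal (x ^ γ.1.length)
                  else 0)
              + ENNReal.ofReal ((1 - θ) * x) *
                (∑' u : H.neighborSet q₃,
                  pathKernelOn H x q₁ u {γ | q₃ ∉ γ.1.support} *
                    pathKernelOn H x q₂ q₄ {γ | q₃ ∉ γ.1.support}) ≤
            ENNReal.ofReal x ^ 3 *
                (∑' (a : H.neighborSet q₃) (b : H.neighborSet q₃) (c : H.neighborSet q₃)
                    (α : (H.deleteEdges (H.incidenceSet q₃)).Path q₁ a)
                    (β : (H.deleteEdges (H.incidenceSet q₃)).Path b q₂)
                    (γ : (H.deleteEdges (H.incidenceSet q₃)).Path c q₄),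
                  if List.Disjoint α.1.support β.1.support ∧ ¬ List.Disjoint β.1.support γ.1.support then
                    ENNReal.ofReal (x ^ α.1.length) * ENNReal.ofReal (x ^ β.1.length) *
                      ENNReal.ofReal (x ^ γ.1.length)
                  else 0)
              + ENNReal.ofReal ((1 - θ) * x) *
                (∑' u : H.neighborSet q₃,
                  pathKernelOn H x q₁ q₂ {γ | q₃ ∉ γ.1.support} *
                    pathKernelOn H x u q₄ {γ | q₃ ∉ γ.1.support}) := by
  sorry

/-! ## Composition (everything below is proved) -/

/-- A graph with finitely many non-isolated vertices has finitely many edges. -/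
theorem edgeSet_finite_of_support_finite {V : Type*} (H : SimpleGraph V) (h : H.support.Finite) :
    H.edgeSet.Finite := by
  refine ((h.prod h).image fun p : V × V => s(p.1, p.2)).subset ?_
  intro e he
  induction e using Sym2.ind with
  | h v w =>
    have hvw : H.Adj v w := (SimpleGraph.mem_edgeSet H).1 he
    exact ⟨(v, w), ⟨(SimpleGraph.mem_support H).2 ⟨w, hvw⟩, (SimpleGraph.mem_support H).2 ⟨v, hvw.symm⟩⟩,
      rfl⟩

/-- The `ℝ≥0∞` bookkeeping of one induction step: recursion identity + star decompositions +
domination + `Main ≥ 0` + finiteness ⇒ TP₂. -/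
theorem tp2_of_corner_data {Z12 Z34 Z13 Z24 V12 V24 Sp Sm T0 TA TB xx κ μ : ℝ≥0∞}
    (hx : xx = κ + μ)
    (hR : Z12 * Z34 + xx * Sm + V24 * Z13 = Z13 * Z24 + xx * Sp + V12 * Z34)
    (hA : V12 * Z34 = T0 + TA) (hB : V24 * Z13 = T0 + TB)
    (hd : TB + κ * Sm ≤ TA + κ * Sp) (hm : Sm ≤ Sp) (hfin : xx * Sp + V12 * Z34 ≠ ∞) :
    Z13 * Z24 ≤ Z12 * Z34 := by
  have h1 : xx * Sm + V24 * Z13 ≤ xx * Sp + V12 * Z34 := by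
    calc xx * Sm + V24 * Z13 = (TB + κ * Sm) + μ * Sm + T0 := by rw [hx, hB]; ring
      _ ≤ (TA + κ * Sp) + μ * Sp + T0 := add_le_add (add_le_add hd (mul_le_mul' le_rfl hm)) le_rfl
      _ = xx * Sp + V12 * Z34 := by rw [hx, hA]; ring
  have h2 : Z13 * Z24 + (xx * Sp + V12 * Z34) ≤ Z12 * Z34 + (xx * Sp + V12 * Z34) := by
    calc Z13 * Z24 + (xx * Sp + V12 * Z34) = Z12 * Z34 + (xx * Sm + V24 * Z13) := by
          rw [← add_assoc, ← add_assoc]; exact hR.symm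
      _ ≤ Z12 * Z34 + (xx * Sp + V12 * Z34) := add_le_add le_rfl h1
  exact ENNReal.le_of_add_le_add_right hfin h2

open Classical in
/-- One induction step at a chosen (non-void) corner `q₃`: the three stubs, the landed corner recursion
and the landed first-step identity give TP₂ for the labelled quadruple `q`. -/
theorem tp2_at_corner (x θ : ℝ) (hx : 0 < x) (hθ0 : 0 < θ) (hθ1 : θ < 1)
    (H : SimpleGraph (Site 2)) (hH : H ≤ zdGraph 2) (hfin : H.support.Finite) (q₁ q₂ q₃ q₄ : Site 2)
    (h₁₂ : q₁ ≠ q₂) (h₁₃ : q₁ ≠ q₃) (h₁₄ : q₁ ≠ q₄) (h₂₃ : q₂ ≠ q₃) (h₂₄ : q₂ ≠ q₄) (h₃₄ : q₃ ≠ q₄)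
    (hI : Interlaced H q₁ q₂ q₃ q₄)
    (ih : ∀ H' : SimpleGraph (Site 2), H' ≤ H → H' ≠ H →
      ∀ r₁ r₂ r₃ r₄ : Site 2, r₁ ≠ r₂ → r₁ ≠ r₃ → r₁ ≠ r₄ → r₂ ≠ r₃ → r₂ ≠ r₄ → r₃ ≠ r₄ →
        Interlaced H' r₁ r₂ r₃ r₄ →
          pathKernel H' x r₁ r₃ * pathKernel H' x r₂ r₄ ≤ pathKernel H' x r₁ r₂ * pathKernel H' x r₃ r₄)
    (hnv : ∃ u, H.Adj q₃ u ∧ u ≠ q₄)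
    (hd : ENNReal.ofReal x ^ 3 *
            (∑' (a : H.neighborSet q₃) (b : H.neighborSet q₃) (c : H.neighborSet q₃)
                (α : (H.deleteEdges (H.incidenceSet q₃)).Path q₁ a)
                (β : (H.deleteEdges (H.incidenceSet q₃)).Path b q₂)
                (γ : (H.deleteEdges (H.incidenceSet q₃)).Path c q₄),
              if List.Disjoint β.1.support γ.1.support ∧ ¬ List.Disjoint α.1.support β.1.support then
                ENNReal.ofReal (x ^ α.1.length) * ENNReal.ofReal (x ^ β.1.length) *
                  ENNReal.ofReal (x ^ γ.1.length)
              else 0)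
          + ENNReal.ofReal ((1 - θ) * x) *
            (∑' u : H.neighborSet q₃,
              pathKernelOn H x q₁ u {γ | q₃ ∉ γ.1.support} *
                pathKernelOn H x q₂ q₄ {γ | q₃ ∉ γ.1.support}) ≤
          ENNReal.ofReal x ^ 3 *
            (∑' (a : H.neighborSet q₃) (b : H.neighborSet q₃) (c : H.neighborSet q₃)
                (α : (H.deleteEdges (H.incidenceSet q₃)).Path q₁ a)
                (β : (H.deleteEdges (H.incidenceSet q₃)).Path b q₂)
                (γ : (H.deleteEdges (H.incidenceSet q₃)).Path c q₄),
              if List.Disjoint α.1.support β.1.support ∧ ¬ List.Disjoint β.1.support γ.1.support then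
                ENNReal.ofReal (x ^ α.1.length) * ENNReal.ofReal (x ^ β.1.length) *
                  ENNReal.ofReal (x ^ γ.1.length)
              else 0)
          + ENNReal.ofReal ((1 - θ) * x) *
            (∑' u : H.neighborSet q₃,
              pathKernelOn H x q₁ q₂ {γ | q₃ ∉ γ.1.support} *
                pathKernelOn H x u q₄ {γ | q₃ ∉ γ.1.support})) :
    pathKernel H x q₁ q₃ * pathKernel H x q₂ q₄ ≤ pathKernel H x q₁ q₂ * pathKernel H x q₃ q₄ := by
  -- `Main ≥ 0` at this corner (stub S1)
  have hm := stub_mainNonneg x hx H hH hfin q₁ q₂ q₃ q₄ h₁₂ h₁₃ h₁₄ h₂₃ h₂₄ h₃₄ hI ih hnv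
  -- the two star decompositions (stub S2)
  obtain ⟨hA, hB⟩ := stub_starDecomposition H x hx.le q₁ q₂ q₃ q₄ h₁₃.symm h₂₃.symm h₃₄
  -- the corner recursion (landed)
  have hR := stub_cornerRecursion H x hx.le q₁ q₂ q₃ q₄ h₁₃.symm h₂₃.symm h₃₄
  -- `x = (1 - θ) x + θ x` in `ℝ≥0∞`
  have hsplit : ENNReal.ofReal x = ENNReal.ofReal ((1 - θ) * x) + ENNReal.ofReal (θ * x) := by
    rw [← ENNReal.ofReal_add (mul_nonneg (by linarith) hx.le) (mul_nonneg hθ0.le hx.le)]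
    congr 1; ring
  -- finiteness of `x S⁺ + V₁₂ Z₃₄ = A₁₂ Z₃₄ + V₁₂ Z₃₄`
  have hSp : ENNReal.ofReal x * (∑' u : H.neighborSet q₃,
        pathKernelOn H x q₁ q₂ {γ | q₃ ∉ γ.1.support} * pathKernelOn H x u q₄ {γ | q₃ ∉ γ.1.support}) =
      pathKernelOn H x q₁ q₂ {γ | q₃ ∉ γ.1.support} * pathKernel H x q₃ q₄ := by
    rw [ENNReal.tsum_mul_left, stub_pathKernel_firstStep H x hx.le q₃ q₄ h₃₄]; ring
  have hne : ∀ a b : Site 2, pathKernel H x a b ≠ ∞ := fun a b => pathKernel_ne_top hfin x a b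
  have hne' : ∀ (a b : Site 2) (S : Set (H.Path a b)), pathKernelOn H x a b S ≠ ∞ := fun a b S =>
    ne_top_of_le_ne_top (hne a b) (pathKernelOn_le x a b S)
  have hfinT : ENNReal.ofReal x * (∑' u : H.neighborSet q₃,
        pathKernelOn H x q₁ q₂ {γ | q₃ ∉ γ.1.support} * pathKernelOn H x u q₄ {γ | q₃ ∉ γ.1.support})
      + pathKernelOn H x q₁ q₂ {γ | q₃ ∈ γ.1.support} * pathKernel H x q₃ q₄ ≠ ∞ := by
    rw [hSp]
    exact ENNReal.add_ne_top.2 ⟨ENNReal.mul_ne_top (hne' _ _ _) (hne _ _),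
      ENNReal.mul_ne_top (hne' _ _ _) (hne _ _)⟩
  exact tp2_of_corner_data hsplit hR hA hB hd hm hfinT

open Classical in
/-- **The induction closes.** For every `0 < x ≤ x_c`, interlacing-only TP₂ `InterlacedTP2At x` holds,
by strong induction on the number of edges of `H`, from the three stubs. -/
theorem interlacedTP2At_of_stubs (x : ℝ) (hx : 0 < x) (hxc : x ≤ SAW.criticalFugacity) :
    InterlacedTP2At x := by
  obtain ⟨θ, hθ0, hθ1, hdom⟩ := stub_starDomination
  suffices key : ∀ n : ℕ, ∀ H : SimpleGraph (Site 2), H ≤ zdGraph 2 → H.support.Finite →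
      H.edgeSet.ncard = n →
      ∀ p₁ p₂ p₃ p₄ : Site 2, p₁ ≠ p₂ → p₁ ≠ p₃ → p₁ ≠ p₄ → p₂ ≠ p₃ → p₂ ≠ p₄ → p₃ ≠ p₄ →
        Interlaced H p₁ p₂ p₃ p₄ →
          pathKernel H x p₁ p₃ * pathKernel H x p₂ p₄ ≤ pathKernel H x p₁ p₂ * pathKernel H x p₃ p₄ by
    intro H hH hfin p₁ p₂ p₃ p₄ h12 h13 h14 h23 h24 h34 hI
    exact key _ H hH hfin rfl p₁ p₂ p₃ p₄ h12 h13 h14 h23 h24 h34 hI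
  intro n
  induction n using Nat.strong_induction_on with
  | _ n ihn =>
  intro H hH hfin hn p₁ p₂ p₃ p₄ h12 h13 h14 h23 h24 h34 hI
  -- the induction hypothesis, as handed to the stubs: every proper subgraph of `H`
  have ih : ∀ H' : SimpleGraph (Site 2), H' ≤ H → H' ≠ H →
      ∀ q₁ q₂ q₃ q₄ : Site 2, q₁ ≠ q₂ → q₁ ≠ q₃ → q₁ ≠ q₄ → q₂ ≠ q₃ → q₂ ≠ q₄ → q₃ ≠ q₄ →
        Interlaced H' q₁ q₂ q₃ q₄ →
          pathKernel H' x q₁ q₃ * pathKernel H' x q₂ q₄ ≤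
            pathKernel H' x q₁ q₂ * pathKernel H' x q₃ q₄ := by
    intro H' hle hneq q₁ q₂ q₃ q₄ g12 g13 g14 g23 g24 g34 hI'
    have hlt : H' < H := lt_of_le_of_ne hle hneq
    have hcard : H'.edgeSet.ncard < n := by
      rw [← hn]
      exact Set.ncard_lt_ncard (SimpleGraph.edgeSet_ssubset_edgeSet.2 hlt)
        (edgeSet_finite_of_support_finite H hfin)
    exact ihn _ hcard H' (hle.trans hH) (hfin.subset (SimpleGraph.support_mono hle)) rfl
      q₁ q₂ q₃ q₄ g12 g13 g14 g23 g24 g34 hI'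
  -- trivial instances
  by_cases h0 : pathKernel H x p₁ p₃ * pathKernel H x p₂ p₄ = 0
  · rw [h0]; exact zero_le
  -- the corner chosen by the domination stub, and the step there
  obtain ⟨q₁, q₂, q₃, q₄, hq, hnv, hd⟩ :=
    hdom x hx hxc H hH hfin p₁ p₂ p₃ p₄ h12 h13 h14 h23 h24 h34 hI ih h0
  rcases hq with hq | hq | hq | hq <;> simp only [Prod.mk.injEq] at hq <;>
    obtain ⟨rfl, rfl, rfl, rfl⟩ := hq
  · exact tp2_at_corner x θ hx hθ0 hθ1 H hH hfin _ _ _ _ h12 h13 h14 h23 h24 h34 hI ih hnv hd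
  · exact tp2_of_swap H x (tp2_at_corner x θ hx hθ0 hθ1 H hH hfin _ _ _ _ h12.symm h24 h23 h14 h13
      h34.symm hI.swap ih hnv hd)
  · exact tp2_of_rotate H x (tp2_at_corner x θ hx hθ0 hθ1 H hH hfin _ _ _ _ h34 h13.symm h23.symm
      h14.symm h24.symm h12 hI.rotate ih hnv hd)
  · exact tp2_of_reflect H x (tp2_at_corner x θ hx hθ0 hθ1 H hH hfin _ _ _ _ h34.symm h24.symm
      h14.symm h23.symm h13.symm h12.symm hI.reflect ih hnv hd)

/-- **Composition of the line**: the crux `BoundaryTP2`, BY NAME, from the three registered stubs —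
the induction gives `InterlacedTP2At x_c`, hence the combinatorial core `GraphTP2At x_c`
(`graphTP2At_of_interlacedTP2At`, landed), hence the crux through the landed transfer
`boundaryTP2_of_graphTP2At`. -/
theorem BoundaryTP2_of :
    Summit.CriticalPhenomena.SAWScalingLimit.Theses.SAWTotalPositivity.BoundaryTP2 :=
  boundaryTP2_of_graphTP2At (graphTP2At_of_interlacedTP2At
    (interlacedTP2At_of_stubs SAW.criticalFugacity SAW.criticalFugacity_pos le_rfl))

end Summit.CriticalPhenomena.SAWScalingLimit.Cruxes.BoundaryTP2.CornerDeletionInduction
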